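import Summits.AtomisticToContinuum.HydrodynamicLimit.Theses.JParityClosure
import Summits.AtomisticToContinuum.HydrodynamicLimit.Theorems.JParityClosureParityRigidityGaussDiff
import Summits.AtomisticToContinuum.HydrodynamicLimit.Theorems.JParityClosureParityRigidityPhase
import Summits.AtomisticToContinuum.HydrodynamicLimit.Theorems.JParityClosureParityRigidityMollify

/-!
# `ParityRigidity`: vanishing even production is rigid (item stmt-AtomisticToContinuum-13084)

We prove the route declaration
`Summit.AtomisticToContinuum.HydrodynamicLimit.Theses.JParityClosure.ParityRigidity`: if `m` is a
probability measure on `ℝ³` with finite second moment and the even entropy production of its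
`ϑ`-Gaussian mollification `h_ϑ = m ∗ G_{ϑ²}` against the ideal hard-sphere contact law,
integrated against `m ⊗ m`, tends to `0` as `ϑ → 0⁺`, then `m` is a point mass or a Maxwellian.

Proof.  Write `μ = m ⊗ m`, transported to the Euclidean product `WithLp 2 (E × E)` as `ν`, and
`T̂_ω` for the (linear, isometric, involutive) collision map.  The surprisal jump is
`F_ϑ(ω, x) = -log ((T̂_ω)_# ν ∗ G_s (x) / ν ∗ G_s (x))`, `s = 2ϑ²` (Gaussian mollification commutes
with the isometry), so by Gaussian relative differentiation
(`ae_tendsto_lintegral_exp_div`) `F_ϑ → -log d(T̂_ω)_# ν/dν` `ν`-a.e.  Tonelli and two Fatou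
lemmas along `ϑ_n = 1/(n+1)` turn the hypothesis into `liminf B Φ(F_{ϑ_n}) = 0` a.e.
(`Φ(y) = y (1 - e^{-y}) ≥ 0` vanishes only at `0`), whence the Radon–Nikodym derivative is `1` on
the half-space charged by the kernel and `μ` is `collide ω`-invariant for a.e. `ω`
(`map_collide_prod_eq_of_ae_rnDeriv`).  Then the characteristic function is multiplicatively
collision invariant for every `ω` (`charFun_mul_eq_of_ae`) and the modulus/phase analysis
(`dirac_or_maxwellian_of_collision_invariant`) identifies `m`.
-/

open MeasureTheory Metric Real Filter Topology Set Complex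
open scoped InnerProductSpace ENNReal NNReal Topology

namespace Summit.AtomisticToContinuum.HydrodynamicLimit.Theorems

open Literature.MathematicalPhysics.KineticTheory Literature.Analysis.FluidPDE
open Summit.AtomisticToContinuum.HydrodynamicLimit.Theorems.ParityRigidity

/-! ### The rigidity theorem -/

section Main

variable {E : Type*} [NormedAddCommGroup E] [InnerProductSpace ℝ E] [FiniteDimensional ℝ E]
  [MeasurableSpace E] [BorelSpace E]

/-- **Rigidity of vanishing even production (general dimension `≥ 2`).** If the even entropy
production of the Gaussian mollifications `h_ϑ = m ∗ G_{ϑ²}` of a probability measure `m` with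
finite second moment, integrated against `m ⊗ m`, tends to `0` as `ϑ → 0⁺`, then `m` is a Dirac
mass or a Maxwellian law. -/
theorem ParityRigidity.dirac_or_maxwellian_of_tendsto (hE : 2 ≤ Module.finrank ℝ E)
    (m : Measure E) [IsProbabilityMeasure m] (hm2 : Integrable (fun v => ‖v‖ ^ 2) m)
    (hlim : let h : ℝ → E → ℝ := fun ϑ v => ∫ v', localMaxwellian 1 (ϑ ^ 2) v v' ∂m
      let F : ℝ → sphere (0 : E) 1 → E × E → ℝ := fun ϑ ω p =>
        Real.log (h ϑ p.1) + Real.log (h ϑ p.2) - Real.log (h ϑ (collide ω p).1) -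
          Real.log (h ϑ (collide ω p).2)
      Tendsto (fun ϑ : ℝ => ∫⁻ p, ∫⁻ ω, ENNReal.ofReal (hardSphereKernel (p.2, p.1) ω *
        (F ϑ ω p * (1 - Real.exp (-F ϑ ω p)))) ∂sphereMeasure ∂(m.prod m))
        (𝓝[>] 0) (𝓝 0)) :
    (∃ u : E, m = Measure.dirac u) ∨
      ∃ θ : ℝ, ∃ u : E, 0 < θ ∧
        m = (volume : Measure E).withDensity fun v => ENNReal.ofReal (localMaxwellian 1 θ u v) := by
  set h : ℝ → E → ℝ := fun ϑ v => ∫ v', localMaxwellian 1 (ϑ ^ 2) v v' ∂m with hh_def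
  set F : ℝ → sphere (0 : E) 1 → E × E → ℝ := fun ϑ ω p =>
    Real.log (h ϑ p.1) + Real.log (h ϑ p.2) - Real.log (h ϑ (collide ω p).1) -
      Real.log (h ϑ (collide ω p).2) with hF_def
  replace hlim : Tendsto (fun ϑ : ℝ => ∫⁻ p, ∫⁻ ω, ENNReal.ofReal (hardSphereKernel (p.2, p.1) ω *
      (F ϑ ω p * (1 - Real.exp (-F ϑ ω p)))) ∂sphereMeasure ∂(m.prod m)) (𝓝[>] 0) (𝓝 0) := hlim
  haveI : IsFiniteMeasure (sphereMeasure : Measure (sphere (0 : E) 1)) := by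
    unfold sphereMeasure; infer_instance
  -- finite first moment
  have h1 : MemLp id 1 m :=
    ((memLp_two_iff_integrable_sq_norm aestronglyMeasurable_id).2 hm2).mono_exponent one_le_two
  -- Step 1: reduce to the collision invariance of `m ⊗ m` for a.e. impact direction
  suffices hinv : ∀ᵐ ω ∂(sphereMeasure : Measure (sphere (0 : E) 1)),
      (m.prod m).map (collide ω) = m.prod m by
    refine dirac_or_maxwellian_of_collision_invariant m hE h1 fun ω ξ η => ?_
    refine charFun_mul_eq_of_ae m ?_ ω ξ η
    filter_upwards [hinv] with ω hω
    exact fun ξ η => charFun_mul_eq_of_map_collide m ω hω ξ η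
  -- Step 2: the sequence `ϑ_n = 1/(n+1)` and the integrands `g_n`
  set ϑs : ℕ → ℝ := fun n => 1 / ((n : ℝ) + 1) with hϑs
  have hϑpos : ∀ n, 0 < ϑs n := fun n => by simp only [hϑs]; positivity
  have hϑ0 : Tendsto ϑs atTop (𝓝 0) := tendsto_one_div_add_atTop_nhds_zero_nat
  have hϑlim : Tendsto ϑs atTop (𝓝[>] 0) :=
    tendsto_nhdsWithin_iff.2 ⟨hϑ0, Eventually.of_forall hϑpos⟩
  set g : ℕ → (E × E) × sphere (0 : E) 1 → ℝ≥0∞ := fun n q =>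
    ENNReal.ofReal (hardSphereKernel (q.1.2, q.1.1) q.2 *
      (F (ϑs n) q.2 q.1 * (1 - Real.exp (-F (ϑs n) q.2 q.1)))) with hg
  have hB : Measurable fun q : (E × E) × sphere (0 : E) 1 => hardSphereKernel (q.1.2, q.1.1) q.2 := by
    refine Continuous.measurable ?_
    show Continuous fun q : (E × E) × sphere (0 : E) 1 => max ⟪q.1.2 - q.1.1, (q.2 : E)⟫_ℝ 0
    fun_prop
  have hc1 : Continuous fun q : (E × E) × sphere (0 : E) 1 => (collide q.2 q.1).1 := by
    show Continuous fun q : (E × E) × sphere (0 : E) 1 =>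
      q.1.1 - ⟪q.1.1 - q.1.2, (q.2 : E)⟫_ℝ • (q.2 : E)
    fun_prop
  have hc2 : Continuous fun q : (E × E) × sphere (0 : E) 1 => (collide q.2 q.1).2 := by
    show Continuous fun q : (E × E) × sphere (0 : E) 1 =>
      q.1.2 + ⟪q.1.1 - q.1.2, (q.2 : E)⟫_ℝ • (q.2 : E)
    fun_prop
  have hg_meas : ∀ n, Measurable (g n) := by
    intro n
    have hhm : Measurable (h (ϑs n)) :=
      ParityRigidity.measurable_integral_localMaxwellian m (ϑs n)
    have hF : Measurable fun q : (E × E) × sphere (0 : E) 1 => F (ϑs n) q.2 q.1 :=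
      (((hhm.comp measurable_fst.fst).log.add (hhm.comp measurable_fst.snd).log).sub
        (hhm.comp hc1.measurable).log).sub (hhm.comp hc2.measurable).log
    exact (hB.mul (hF.mul (measurable_const.sub hF.neg.exp))).ennreal_ofReal
  -- Step 3: Tonelli and Fatou in the impact direction
  have hI : Tendsto (fun n => ∫⁻ p, ∫⁻ ω, g n (p, ω) ∂sphereMeasure ∂(m.prod m)) atTop (𝓝 0) :=
    hlim.comp hϑlim
  have hswap : ∀ n, ∫⁻ p, ∫⁻ ω, g n (p, ω) ∂sphereMeasure ∂(m.prod m) =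
      ∫⁻ ω, ∫⁻ p, g n (p, ω) ∂(m.prod m) ∂sphereMeasure := fun n =>
    lintegral_lintegral_swap (hg_meas n).aemeasurable
  have hG_meas : ∀ n, Measurable fun ω : sphere (0 : E) 1 => ∫⁻ p, g n (p, ω) ∂(m.prod m) :=
    fun n => (hg_meas n).lintegral_prod_left'
  have hI' : Tendsto (fun n => ∫⁻ ω, ∫⁻ p, g n (p, ω) ∂(m.prod m) ∂sphereMeasure) atTop (𝓝 0) := by
    simpa only [hswap] using hI
  have hFatou1 : ∫⁻ ω, liminf (fun n => ∫⁻ p, g n (p, ω) ∂(m.prod m)) atTop ∂sphereMeasure = 0 :=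
    le_antisymm ((lintegral_liminf_le hG_meas).trans (le_of_eq hI'.liminf_eq)) bot_le
  have hae1 : ∀ᵐ ω ∂(sphereMeasure : Measure (sphere (0 : E) 1)),
      liminf (fun n => ∫⁻ p, g n (p, ω) ∂(m.prod m)) atTop = 0 :=
    (lintegral_eq_zero_iff (Measurable.liminf hG_meas)).1 hFatou1
  filter_upwards [hae1] with ω hω
  replace hω : liminf (fun n => ∫⁻ p, g n (p, ω) ∂(m.prod m)) atTop = 0 := hω
  -- Step 4: Fatou in the velocity pair
  have hgp_meas : ∀ n, Measurable fun p : E × E => g n (p, ω) := fun n =>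
    (hg_meas n).comp measurable_prodMk_right
  have hFatou2 : ∫⁻ p, liminf (fun n => g n (p, ω)) atTop ∂(m.prod m) = 0 :=
    le_antisymm ((lintegral_liminf_le hgp_meas).trans (le_of_eq hω)) bot_le
  have hae2 : ∀ᵐ p ∂(m.prod m), liminf (fun n => g n (p, ω)) atTop = 0 :=
    (lintegral_eq_zero_iff (Measurable.liminf hgp_meas)).1 hFatou2
  -- Step 5: transport to the Euclidean product and apply the invariance criterion
  refine map_collide_prod_eq_of_ae_rnDeriv m ω ?_
  set ν : Measure (WithLp 2 (E × E)) := (m.prod m).map (WithLp.toLp 2) with hν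
  set T : WithLp 2 (E × E) → WithLp 2 (E × E) :=
    fun x : WithLp 2 (E × E) => WithLp.toLp 2 (collide ω (WithLp.ofLp x)) with hT
  have hTm : Measurable T :=
    (WithLp.measurable_toLp 2 _).comp
      ((ParityRigidity.continuous_collide ω).measurable.comp (WithLp.measurable_ofLp 2 _))
  haveI : IsFiniteMeasure (ν.map T) := Measure.isFiniteMeasure_map ν T
  have hGD := ae_tendsto_lintegral_exp_div ν (ν.map T)
  have hfin := Measure.rnDeriv_lt_top (ν.map T) ν
  have hemb : MeasurableEmbedding (WithLp.toLp 2 : E × E → WithLp 2 (E × E)) :=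
    (MeasurableEquiv.toLp 2 (E × E)).measurableEmbedding
  have hae2' : ∀ᵐ x ∂ν, liminf (fun n => g n (WithLp.ofLp x, ω)) atTop = 0 := by
    rw [hν, hemb.ae_map_iff]
    simpa only [WithLp.ofLp_toLp] using hae2
  filter_upwards [hGD, hfin, hae2'] with x hx hxfin hx0 hpos
  -- Step 6: the pointwise argument at a good point `x`
  have hBpos : 0 < hardSphereKernel ((WithLp.ofLp x).2, (WithLp.ofLp x).1) ω :=
    lt_max_of_lt_left hpos
  set r : ℕ → ℝ≥0∞ := fun n =>
    (∫⁻ z, ENNReal.ofReal (Real.exp (-‖x - z‖ ^ 2 / (2 * ϑs n ^ 2))) ∂(ν.map T)) /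
      ∫⁻ z, ENNReal.ofReal (Real.exp (-‖x - z‖ ^ 2 / (2 * ϑs n ^ 2))) ∂ν with hr_def
  have hs : Tendsto (fun n => 2 * ϑs n ^ 2) atTop (𝓝[>] 0) := by
    refine tendsto_nhdsWithin_iff.2 ⟨?_, Eventually.of_forall fun n => ?_⟩
    · simpa using (hϑ0.pow 2).const_mul 2
    · exact mul_pos two_pos (pow_pos (hϑpos n) 2)
  have hr : Tendsto r atTop (𝓝 ((ν.map T).rnDeriv ν x)) := hx.comp hs
  have hS : ∀ n, r n ≠ 0 ∧ r n ≠ ⊤ ∧ F (ϑs n) ω (WithLp.ofLp x) = -Real.log (r n).toReal := by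
    intro n
    have h := ParityRigidity.surprisal_eq m (hϑpos n).ne' ω (WithLp.ofLp x) ν T hν hT
    simp only [WithLp.toLp_ofLp] at h
    exact h
  have hfun : ∀ n, g n (WithLp.ofLp x, ω) =
      ENNReal.ofReal (hardSphereKernel ((WithLp.ofLp x).2, (WithLp.ofLp x).1) ω *
        (-Real.log (r n).toReal * (1 - Real.exp (-(-Real.log (r n).toReal))))) := by
    intro n
    simp only [hg]
    rw [(hS n).2.2]
  simp only [hfun] at hx0
  exact ParityRigidity.eq_one_of_liminf_eq_zero hxfin.ne hr (fun n => (hS n).1)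
    (fun n => (hS n).2.1) hBpos hx0

end Main

/-- **Item stmt-AtomisticToContinuum-13084** (`ParityRigidity`, route JParityClosure): vanishing
even production of the Gaussian mollifications forces a point mass or a Maxwellian law. -/
theorem parityRigidity_proof :
    Summit.AtomisticToContinuum.HydrodynamicLimit.Theses.JParityClosure.ParityRigidity := by
  intro m _ hm2 hlim
  have hE : 2 ≤ Module.finrank ℝ V3 := by
    rw [finrank_euclideanSpace_fin]
    norm_num
  exact ParityRigidity.dirac_or_maxwellian_of_tendsto hE m hm2 hlim

end Summit.AtomisticToContinuum.HydrodynamicLimit.Theorems
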